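import Literature.IUT.LogVolume.DifferentDivisorTower
import Literature.IUT.LogVolume.ConductorDivisorBound
import Literature.NumberTheory.NumberFields.RelativeDifferentExponents
import HarnessLib

/-!
# [IUTchIV] Theorem 1.10, Step (ii), for REAL towers of number fields: log-different plus log-conductor
# along `F ⊆ K`

Mochizuki, *Inter-universal Teichmüller theory IV*, RIMS manuscript (Apr. 2020; = PRIMS **57** (2021)),
Theorem 1.10, notation p. 22–23 and proof Step (ii), p. 24 (kurims `paper:url-56bcb0f95768`, read on the
page). For an intermediate field `F□` of `F_mod ⊆ K` the statement fixes (pp. 22–23) `𝔡^{F□}_ADiv ∈ ADiv_ℝ(F□)`,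
"the effective arithmetic divisor determined by the different ideal of `F□` over `ℚ`", and `𝔣^{F□}_ADiv`, "the
effective arithmetic divisor whose support coincides with `Supp(𝔮^{F□}_ADiv)`, but all of whose coefficients are
equal to `1` — i.e., the conductor" (supported on `𝕍(F□)^bad = 𝕍^bad_mod ×_{𝕍_mod} 𝕍(F□)`), and
`log(𝔡^{F□}) := deg(𝔡^{F□}_ADiv)`, `log(𝔣^{F□}) := deg(𝔣^{F□}_ADiv)` (normalized degrees, Def. 1.9). Step (ii)
(p. 24) then asserts, for the tower `F_tpd ⊆ F ⊆ K`:

> "the inequality `log(𝔡^{F_tpd}) + log(𝔣^{F_tpd}) ≤ log(𝔡^F) + log(𝔣^F)` follows immediately from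
> Proposition 1.3, (i) … the inequality `log(𝔡^F) + log(𝔣^F) ≤ log(𝔡^{F_tpd}) + log(𝔣^{F_tpd}) +
> log(2^11·3^3·5^2)` follows by applying Proposition 1.3, (i), at the primes that do not divide `2·3·5` [where …
> `F/F_tpd` is tamely ramified over such primes — cf. Proposition 1.8, (vi), (vii)] and applying Proposition
> 1.3, (ii), together with (E3), (E4), (E5), (E6), and the fact that we have a natural outer inclusion
> `Gal(F/F_tpd) ↪ GL_2(𝔽_3) × GL_2(𝔽_5) × ℤ/2ℤ`, at the primes that divide `2·3·5`. In a similar vein, since the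
> extension `K/F` is tamely ramified at the primes that do not divide `l`, and we have a natural outer inclusion
> `Gal(K/F) ↪ GL_2(𝔽_l)`, the inequality `log(𝔡^K) ≤ log(𝔡^K) + log(𝔣^K) ≤ log(𝔡^F) + log(𝔣^F) + 2·log(l)`
> follows".

The tree's `Theorem110StepII.lean` (abc-iut-S3) checks this ASSEMBLY over abstract per-place data
(`Thm110StepII.PlaceData`), and `Theorem110Data.lean` carries the three displays as the named hypotheses
`tpd_le_F`, `F_le`, `K_le` of `Thm110Numerics.ProofData`. THIS FILE proves the three displays for ACTUAL
number fields `F ⊆ K` (read `F_tpd ⊆ F`, resp. `F ⊆ K`), in the arithmetic-divisor vocabulary of this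
directory: `𝔡^L_ADiv = differentDivisor L` (`IdealArithmeticDivisors`), `𝔣^L_ADiv = ADivisor.reduced T` for
the finite set `T` of bad places of `L`, `deg = ndeg` (`RArithmeticDivisors`), the places of `K` over the bad
places `S` of `F` being described by `hT : w ∈ T ↔ finBelow F K w ∈ S` (= `𝕍^bad ×_{𝕍(F)} 𝕍(K)`):

* `degF_eq_sum_of_subset` — `deg_K` of a divisor supported on finite places as a sum over any finite set of
  finite places containing its support (the lower bound by the part over any finite set, for an effective
  divisor, is the tree's `sum_inr_mul_logNorm_le_degF`, `ConductorDivisorBound`);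
* `finrank_mul_degF_reduced_eq_sum` — **`[K:F]·deg_F(𝔣^F) = Σ_{w ∈ T} e(w|v)·log N(w)`** (the fundamental
  identity `Σ_{w|v} e(w|v) f(w|v) = [K:F]` place by place; `pullbackWeight_inr_eq`, `ramIdx_eq` identify the
  tree's weights with Mathlib's `Ideal.ramificationIdx` over `𝓞 F`, resp. `ℤ`);
* `ndeg_different_add_reduced_mono` — **first display, UNCONDITIONAL**:
  `deg(𝔡^F) + deg(𝔣^F) ≤ deg(𝔡^K) + deg(𝔣^K)` — by Dedekind's `e(w|v) - 1 ≤ ord_w 𝔡_{K/F}` (the relative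
  form of Prop. 1.3 (i)) the loss `Σ_{w bad} (e(w|v) - 1)·log N(w)` of the REDUCED conductor under pull-back
  is paid for by the relative different (`log N(𝔡_{K/F}) = [K:ℚ]·(deg(𝔡^K) - deg(𝔡^F))`,
  `DifferentDivisorTower`). This is `ProofData.tpd_le_F` for actual number fields.

The second and third displays (tame/unramified outside `P` plus the Prop. 1.3 (ii)-type bound over `P`, with
the printed constants `log(2^11·3^3·5^2)` and `2·log(l)` in the Galois case) are the sequel
`DifferentConductorTowerBounds.lean`. The per-prime inputs are `Literature/NumberTheory/NumberFields/RelativeDifferentExponents.lean` (Neukirch,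
*Algebraic Number Theory*, III (2.6)). What remains HYPOTHESIS here is exactly what the printed proof takes from
elsewhere: which places are tame/unramified (Prop. 1.8 (vi), (vii), (D0), semi-stable reduction) and the
Galois groups of `F/F_tpd`, `K/F` (torsion fields of the elliptic curve). No log-volume computation and no
statement of [IUTchIII] is involved; nothing here takes a side on Cor. 3.12; classical algebraic number
theory kernel-checked, the [IUTchIV] locators recording what it instantiates.
-/

noncomputable section

namespace Literature.IUT.LogVolume

open NumberField IsDedekindDomain Finset
open Literature.NumberTheory.NumberFields (ramificationIdx_sub_one_le_multiplicity_differentIdeal)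
open scoped Classical

variable (F K : Type*) [Field F] [NumberField F] [Field K] [NumberField K] [Algebra F K]

/-! ### Degrees of divisors supported on finite places, as sums over finite sets of places -/

section FiniteSupport

/-- `deg_K` of a divisor with no archimedean part, as a sum over any finite set of finite places
containing its support: `deg_K(𝔞) = Σ_{w ∈ D} c_w · log N(w)`.
[cite: Mochizuki2012, IUTchIV Def. 1.9 (i) p. 21] -/
theorem degF_eq_sum_of_subset (a : ADivisor K) (D : Finset (HeightOneSpectrum (𝓞 K)))
    (h0 : ∀ w : InfinitePlace K, a (Sum.inl w) = 0) (hD : ∀ w, a (Sum.inr w) ≠ 0 → w ∈ D) :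
    degF K a = ∑ w ∈ D, a (Sum.inr w) * logNorm K w := by
  rw [degF_apply, Finsupp.sum]
  have hsub : a.support ⊆ D.map ⟨Sum.inr, Sum.inr_injective⟩ := by
    intro x hx
    rw [Finsupp.mem_support_iff] at hx
    rcases x with w | w
    · exact absurd (h0 w) hx
    · exact Finset.mem_map.mpr ⟨w, hD w hx, rfl⟩
  rw [Finset.sum_subset hsub (fun x _ hx => by rw [Finsupp.notMem_support_iff.mp hx, zero_mul]),
    Finset.sum_map]
  rfl

end FiniteSupport

/-! ### The conductor side: `[K:F] · deg_F(𝔣^F) = Σ_{w over S} e(w|v) · log N(w)` -/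

section Conductor

variable {F K}

/-- The places of `K` above the nonarchimedean places in `S ⊆ 𝕍(F)^non`, as a set of places of `K`:
`(S ↪ 𝕍(F))|_K = T ↪ 𝕍(K)` when `T` is the set of finite places of `K` over `S`.
[cite: Mochizuki2012, IUTchIV Def. 1.9 (ii) p. 22] -/
theorem biUnion_placesAbove_eq_map (S : Finset (HeightOneSpectrum (𝓞 F)))
    (T : Finset (HeightOneSpectrum (𝓞 K))) (hT : ∀ w, w ∈ T ↔ finBelow F K w ∈ S) :
    (S.map ⟨Sum.inr, Sum.inr_injective⟩).biUnion (placesAbove F K) =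
      T.map ⟨Sum.inr, Sum.inr_injective⟩ := by
  ext x
  simp only [Finset.mem_biUnion, Finset.mem_map, Function.Embedding.coeFn_mk, mem_placesAbove_iff]
  constructor
  · rintro ⟨_, ⟨v, hv, rfl⟩, hx⟩
    rcases x with w | w
    · simp [Place.below] at hx
    · refine ⟨w, (hT w).mpr ?_, rfl⟩
      have : finBelow F K w = v := by simpa [Place.below] using hx
      rwa [this]
  · rintro ⟨w, hw, rfl⟩
    exact ⟨Sum.inr (finBelow F K w), ⟨finBelow F K w, (hT w).mp hw, rfl⟩, by simp [Place.below]⟩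

variable (F K)

/-- **`[K:F] · deg_F(Σ_{v∈S} v) = Σ_{w over S} e(w|v) · log N(w)`**: the fundamental identity
`Σ_{w|v} e(w|v) f(w|v) = [K:F]` place by place (`log N(w) = f(w|v)·log N(v)`).
[cite: Mochizuki2012, IUTchIV Def. 1.9 (i) p. 22] -/
theorem finrank_mul_degF_reduced_eq_sum (S : Finset (HeightOneSpectrum (𝓞 F)))
    (T : Finset (HeightOneSpectrum (𝓞 K))) (hT : ∀ w, w ∈ T ↔ finBelow F K w ∈ S) :
    (Module.finrank F K : ℝ) * degF F (ADivisor.reduced S) =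
      ∑ w ∈ T, (pullbackWeight F K (Sum.inr w) : ℝ) * logNorm K w := by
  rw [ADivisor.degF_reduced_eq_sum, Finset.mul_sum]
  have h1 : ∀ v ∈ S, (Module.finrank F K : ℝ) * logNorm F v =
      ∑ x ∈ placesAbove F K (Sum.inr v), (pullbackWeight F K x : ℝ) * degWeight K x := by
    intro v _
    rw [sum_pullbackWeight_mul_degWeight, degWeight_inr]
  rw [Finset.sum_congr rfl h1]
  have h2 : ∑ v ∈ S, ∑ x ∈ placesAbove F K (Sum.inr v), (pullbackWeight F K x : ℝ) * degWeight K x =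
      ∑ x ∈ (S.map ⟨Sum.inr, Sum.inr_injective⟩).biUnion (placesAbove F K),
        (pullbackWeight F K x : ℝ) * degWeight K x := by
    rw [Finset.sum_biUnion (fun v _ v' _ hne => pairwiseDisjoint_placesAbove (K := K) Set.univ
      (Set.mem_univ _) (Set.mem_univ _) hne), Finset.sum_map]
    rfl
  rw [h2, biUnion_placesAbove_eq_map S T hT, Finset.sum_map]
  rfl

omit [NumberField F] in
/-- The pull-back weight at a finite place is the relative ramification index `e(w | w ∩ 𝓞 F)` (Mathlib's
`Ideal.ramificationIdx` over `𝓞 F`). [cite: Mochizuki2012, IUTchIV Def. 1.9 (i) p. 22] -/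
theorem pullbackWeight_inr_eq (w : HeightOneSpectrum (𝓞 K)) :
    pullbackWeight F K (Sum.inr w) = w.asIdeal.ramificationIdx (𝓞 F) := by
  simp only [pullbackWeight]
  exact Ideal.ramificationIdx'_eq_ramificationIdx (finBelow F K w).asIdeal w.asIdeal (finBelow F K w).ne_bot

/-- The absolute ramification index `e_w = e(w | p_w)` of `FakeAdeleIndex` is Mathlib's `Ideal.ramificationIdx`
over `ℤ`. [cite: Mochizuki2012, IUTchIV Def. 1.9 p. 21] -/
theorem ramIdx_eq (w : HeightOneSpectrum (𝓞 K)) : ramIdx K w = w.asIdeal.ramificationIdx ℤ := by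
  rw [ramIdx]
  exact Ideal.ramificationIdx'_eq_ramificationIdx _ w.asIdeal (by
    simp [(residueChar_prime K w).ne_zero])

end Conductor

/-! ### Step (ii), first display: `log(𝔡^{L₀}) + log(𝔣^{L₀}) ≤ log(𝔡^L) + log(𝔣^L)` — unconditional -/

section FirstDisplay

/-- The key estimate behind the first display, unnormalised:
`[K:F]·deg_F(𝔣^F) ≤ deg_K(𝔡_{K/F}) + deg_K(𝔣^K)`, i.e. `Σ_{w over S} (e(w|v) - 1)·log N(w) ≤ log N(𝔡_{K/F})`
(Dedekind: `e(w|v) - 1 ≤ ord_w 𝔡_{K/F}` at every `w`). [claim: Mochizuki2012, status: disputed] -/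
theorem finrank_mul_degF_reduced_le (S : Finset (HeightOneSpectrum (𝓞 F)))
    (T : Finset (HeightOneSpectrum (𝓞 K))) (hT : ∀ w, w ∈ T ↔ finBelow F K w ∈ S) :
    (Module.finrank F K : ℝ) * degF F (ADivisor.reduced S) ≤
      degF K (relDifferentDivisor F K) + degF K (ADivisor.reduced T) := by
  rw [finrank_mul_degF_reduced_eq_sum F K S T hT, ADivisor.degF_reduced_eq_sum]
  have h1 : ∑ w ∈ T, relDifferentDivisor F K (Sum.inr w) * logNorm K w ≤ degF K (relDifferentDivisor F K) :=
    sum_inr_mul_logNorm_le_degF (relDifferentDivisor_isEffective F K) T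
  have h2 : ∀ w ∈ T, (pullbackWeight F K (Sum.inr w) : ℝ) * logNorm K w ≤
      relDifferentDivisor F K (Sum.inr w) * logNorm K w + logNorm K w := by
    intro w _
    haveI : w.asIdeal.IsMaximal := w.isMaximal
    rw [pullbackWeight_inr_eq, relDifferentDivisor, ADivisor.ofIdeal_apply_inr (relDifferentIdeal_ne_bot F K)]
    have hle := ramificationIdx_sub_one_le_multiplicity_differentIdeal F K w.asIdeal
    have hl := (logNorm_pos K w).le
    have hcast : (w.asIdeal.ramificationIdx (𝓞 F) : ℝ) ≤
        (multiplicity w.asIdeal (differentIdeal (𝓞 F) (𝓞 K)) : ℝ) + 1 := by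
      exact_mod_cast (by omega : w.asIdeal.ramificationIdx (𝓞 F) ≤
        multiplicity w.asIdeal (differentIdeal (𝓞 F) (𝓞 K)) + 1)
    nlinarith
  calc ∑ w ∈ T, (pullbackWeight F K (Sum.inr w) : ℝ) * logNorm K w
      ≤ ∑ w ∈ T, (relDifferentDivisor F K (Sum.inr w) * logNorm K w + logNorm K w) := Finset.sum_le_sum h2
    _ = ∑ w ∈ T, relDifferentDivisor F K (Sum.inr w) * logNorm K w + ∑ w ∈ T, logNorm K w :=
        Finset.sum_add_distrib
    _ ≤ degF K (relDifferentDivisor F K) + ∑ w ∈ T, logNorm K w := by linarith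

/-- **[IUTchIV] Thm. 1.10, Step (ii), first display, for real number fields** — UNCONDITIONAL: for number
fields `F ⊆ K`, a finite set `S` of finite places of `F` ("bad places") and `T` = the finite places of `K`
over `S`: `deg(𝔡^F_ADiv) + deg(𝔣^F_ADiv) ≤ deg(𝔡^K_ADiv) + deg(𝔣^K_ADiv)`, where `𝔡^L_ADiv` is the different
divisor of `L/ℚ` and `𝔣^L_ADiv` the reduced divisor on the bad places of `L` (p. 22: "the effective arithmetic
divisor whose support coincides with `Supp(𝔮^{F□}_ADiv)`, but all of whose coefficients are equal to `1` — i.e.,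
the conductor"), `deg` the normalized degree of Def. 1.9. Printed (p. 24, `L₀ = F_tpd`, `L = F`): "the
inequality `log(𝔡^{F_tpd}) + log(𝔣^{F_tpd}) ≤ log(𝔡^F) + log(𝔣^F)` follows immediately from Proposition 1.3,
(i)". This is the field `tpd_le_F` of `Thm110Numerics.ProofData` for actual number fields: the loss
`(e(w|v) - 1)·log N(w)` of the reduced conductor at a ramified bad place is paid for by Dedekind's
`e(w|v) - 1 ≤ ord_w 𝔡_{K/F}`. [claim: Mochizuki2012, status: disputed] -/
theorem ndeg_different_add_reduced_mono (S : Finset (HeightOneSpectrum (𝓞 F)))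
    (T : Finset (HeightOneSpectrum (𝓞 K))) (hT : ∀ w, w ∈ T ↔ finBelow F K w ∈ S) :
    ndeg F (differentDivisor F) + ndeg F (ADivisor.reduced S) ≤
      ndeg K (differentDivisor K) + ndeg K (ADivisor.reduced T) := by
  have hF : (0 : ℝ) < Module.finrank ℚ F := by exact_mod_cast Module.finrank_pos
  have hKF : (0 : ℝ) < Module.finrank F K := by exact_mod_cast Module.finrank_pos
  have key := finrank_mul_degF_reduced_le F K S T hT
  rw [ndeg_differentDivisor_tower F K, ndeg_apply F (ADivisor.reduced S), ndeg_apply K (relDifferentDivisor F K),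
    ndeg_apply K (ADivisor.reduced T), finrank_rat_eq_mul (F := F) (K := K)]
  have h : degF F (ADivisor.reduced S) / Module.finrank ℚ F ≤
      degF K (relDifferentDivisor F K) / (Module.finrank F K * Module.finrank ℚ F) +
        degF K (ADivisor.reduced T) / (Module.finrank F K * Module.finrank ℚ F) := by
    rw [← add_div, div_le_div_iff₀ hF (mul_pos hKF hF)]
    calc degF F (ADivisor.reduced S) * (Module.finrank F K * Module.finrank ℚ F)
        = (Module.finrank F K * degF F (ADivisor.reduced S)) * Module.finrank ℚ F := by ring
      _ ≤ (degF K (relDifferentDivisor F K) + degF K (ADivisor.reduced T)) * Module.finrank ℚ F :=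
          mul_le_mul_of_nonneg_right key hF.le
  linarith

end FirstDisplay

end Literature.IUT.LogVolume

end
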